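import Summits.QuantumFields.BalabanUV.Beta.GAN24.ZeroModeFubini

/-!
# `BalabanUV.Beta.GAN24.ZeroModeFubiniTails` — binder row G-an2-4 / (CONV-C), W-slot road W3 (F2) (Z0) («T2-ZERO-MODE-KERNEL*», leaf-02 gen 15):
# TAILS OF THE LEFT NEST OF `ZeroModeFubini` AS SINGLE PRODUCT SUMS, AND THE SUMMABILITY OF ITS THREE OUTER SLOTS

NOT IN PRINT; OUR BOOKKEEPING (G-an2-4 formalisation swarm, leaf seat `b2b-balaban-gan24-formalise-leaf-02`, gen 15).  HONEST FRAMING (cell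
contract, verbatim): «discharging `BetaPertH` makes Bałaban's UV stability UNCONDITIONAL — a real constructive-QFT result; it is NOT the continuum
limit and NOT the Clay problem.»  HONEST DEPENDENCY (verbatim): «continuum YM on T⁴ ⇐ BetaPertH ∧ nine spine estimates (0/9 proved); BetaPertH ⇐
(D1) ∧ (D4) ∧ CAP+tail; G-an2-4 gates asym, D1 and NE2/3/4.»  [folklore] pure rearrangement (Mathlib `Summable.tsum_prod` ∕ `prod_factor` ∕ `prod`);
cites nothing, mints no `def … : Prop`, instantiates no wall binder, asserts NO shape of Bałaban's tables; discharges NOTHING; NOT «W-slot closed»,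
NEVER «G-an2-4 closed»; NOT `BetaPertH`, NOT continuum, NOT Clay.

## What (any types `S`, finite `F`, `I`; the same content was also filed as an additive v1.1 of `ZeroModeFubini`, p212769 — whichever lands)

`tsum_tail₃∕₂∕₁`: for a summable uncurried integrand on `ZeroModeFubini.PiL`, the eight ∕ nine ∕ ten-slot tails of the LEFT nest at fixed
`(y′, x′, z′)` ∕ `(y′, x′)` ∕ `y′` are the corresponding single product sums; `summable_nested₁∕₂∕₃`: the three outer slots of the LEFT nest are
summable (`y′` against the inner double sum, `x′` against `Σ'_{z′}`, `z′`) — the input of the additivity of the period-1 charge of the transported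
second-order table (`GAN24/LinT2ZeroModeSlices.zmode_one_add`).
-/

noncomputable section

open Finset
open scoped BigOperators
open Summit.QuantumFields.BalabanUV.Beta.GAN24.ZeroModeFubini (PiL uncurryL)

namespace Summit.QuantumFields.BalabanUV.Beta.GAN24.ZeroModeFubiniTails

variable {S F I : Type*} [Fintype F] [Fintype I]

/-- [folklore] The eight-slot tail of the LEFT nest at fixed `(y′, x′, z′)`, as one product sum. -/
theorem tsum_tail₃ (Φ : S → S → S → S → F → S → F → I → S → I → S → ℝ) (hΦ : Summable (uncurryL Φ)) (y' x' z' : S) :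
    (∑' r, uncurryL Φ (y', (x', (z', r)))) = ∑' z, ∑ g, ∑' x, ∑ f, ∑ κ, ∑' u, ∑ κ', ∑' u', Φ y' x' z' z g x f κ u κ' u' := by
  have h3 := ((hΦ.prod_factor y').prod_factor x').prod_factor z'
  rw [h3.tsum_prod]
  refine tsum_congr fun z => ?_
  have h4 := h3.prod_factor z
  rw [h4.tsum_prod, tsum_fintype]
  refine Finset.sum_congr rfl fun g _ => ?_
  have h5 := h4.prod_factor g
  rw [h5.tsum_prod]
  refine tsum_congr fun x => ?_
  have h6 := h5.prod_factor x
  rw [h6.tsum_prod, tsum_fintype]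
  refine Finset.sum_congr rfl fun f _ => ?_
  have h7 := h6.prod_factor f
  rw [h7.tsum_prod, tsum_fintype]
  refine Finset.sum_congr rfl fun κ _ => ?_
  have h8 := h7.prod_factor κ
  rw [h8.tsum_prod]
  refine tsum_congr fun u => ?_
  have h9 := h8.prod_factor u
  rw [h9.tsum_prod, tsum_fintype]
  refine Finset.sum_congr rfl fun κ' _ => ?_
  rfl

/-- [folklore] The nine-slot tail at fixed `(y′, x′)`. -/
theorem tsum_tail₂ (Φ : S → S → S → S → F → S → F → I → S → I → S → ℝ) (hΦ : Summable (uncurryL Φ)) (y' x' : S) :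
    (∑' r, uncurryL Φ (y', (x', r))) = ∑' z', ∑' z, ∑ g, ∑' x, ∑ f, ∑ κ, ∑' u, ∑ κ', ∑' u', Φ y' x' z' z g x f κ u κ' u' := by
  rw [((hΦ.prod_factor y').prod_factor x').tsum_prod]
  exact tsum_congr fun z' => tsum_tail₃ Φ hΦ y' x' z'

/-- [folklore] The ten-slot tail at fixed `y′`. -/
theorem tsum_tail₁ (Φ : S → S → S → S → F → S → F → I → S → I → S → ℝ) (hΦ : Summable (uncurryL Φ)) (y' : S) :
    (∑' r, uncurryL Φ (y', r)) = ∑' x', ∑' z', ∑' z, ∑ g, ∑' x, ∑ f, ∑ κ, ∑' u, ∑ κ', ∑' u', Φ y' x' z' z g x f κ u κ' u' := by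
  rw [(hΦ.prod_factor y').tsum_prod]
  exact tsum_congr fun x' => tsum_tail₂ Φ hΦ y' x'

/-- [folklore] **SUMMABILITY OF THE OUTERMOST SLOT** of the LEFT nest: `y′ ↦ Σ'_{x′} Σ'_{z′} …` is summable. -/
theorem summable_nested₁ (Φ : S → S → S → S → F → S → F → I → S → I → S → ℝ) (hΦ : Summable (uncurryL Φ)) :
    Summable fun y' => ∑' x', ∑' z', ∑' z, ∑ g, ∑' x, ∑ f, ∑ κ, ∑' u, ∑ κ', ∑' u', Φ y' x' z' z g x f κ u κ' u' :=
  hΦ.prod.congr fun y' => tsum_tail₁ Φ hΦ y'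

/-- [folklore] Summability of the second slot at fixed `y′`. -/
theorem summable_nested₂ (Φ : S → S → S → S → F → S → F → I → S → I → S → ℝ) (hΦ : Summable (uncurryL Φ)) (y' : S) :
    Summable fun x' => ∑' z', ∑' z, ∑ g, ∑' x, ∑ f, ∑ κ, ∑' u, ∑ κ', ∑' u', Φ y' x' z' z g x f κ u κ' u' :=
  (hΦ.prod_factor y').prod.congr fun x' => tsum_tail₂ Φ hΦ y' x'

/-- [folklore] Summability of the third slot at fixed `(y′, x′)`. -/
theorem summable_nested₃ (Φ : S → S → S → S → F → S → F → I → S → I → S → ℝ) (hΦ : Summable (uncurryL Φ)) (y' x' : S) :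
    Summable fun z' => ∑' z, ∑ g, ∑' x, ∑ f, ∑ κ, ∑' u, ∑ κ', ∑' u', Φ y' x' z' z g x f κ u κ' u' :=
  ((hΦ.prod_factor y').prod_factor x').prod.congr fun z' => tsum_tail₃ Φ hΦ y' x' z'

end Summit.QuantumFields.BalabanUV.Beta.GAN24.ZeroModeFubiniTails
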